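import Summits.QuantumFields.BalabanUV.Beta.MultiscaleCubesFamily

/-!
# Beta / MultiscaleParametrixCubes — NODE (w4-a′), ROUTE C ASSEMBLY: the cube-indexed scale-adapted partition of unity `cubeFam`
# (print's own (2.36) shape) satisfies every DATA hypothesis of `MultiscaleParametrixTorus.parametrix_torus_adapted`, so the
# LEVEL-FREE parametrix holds for it (MODEL; torus `UT N`, covering cube family of `MultiscaleDecay`)

INPUT (all DATA): the covering disjoint cube family (levels `J`, sides `S_l`, cells `k : K`), `A = levelOp …` of `MultiscaleDecay` with a
cell-sum coercivity `C > 0` (isometric `Rm`, `T`), a CONSTANT bond weight `c ≡ c₀`, level weights `|ω_l| ≤ ω̄_l` with `|a_l|ω̄_l²S_l^d ≤ a_max/S_l²`;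
`M ≥ 1` with `M·S_j ∣ N_i`, `2M·S_j ≤ N_i`; a LAYER PREDICATE `inLayer j z` on the cubes of the `M S_j`-grids with (C0) COVER (every point lies
in a layer cube), (C1) boxes active at points within distance `2` have comparable scales `S_j ≤ L·S_{j′}`, (C2) at most `n_adj` layers active at a
point, (G1) the bumps of layer `j` VANISH on the family cells whose level is not ADJACENT to `j` (`S_j ≤ L·S_l ∧ S_l ≤ L·S_j`), at most `n_adj`
levels adjacent to any `j`; (G2) for every ACTIVE box the family cells meeting the `((d+2)M S_j + 1)`-ball round its corner have side `≤ L·S_j`;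
(G3) at most `ν` box hulls through a site.
CONSTRUCTION: `cubeFam = puNorm rawFam` (`MultiscaleCubesFamily`); `cubeHull ⟨j, z⟩` = `MultiscaleParametrixHull.cellHull (ctrU z) ((d+2)M S_j)`
for active boxes, `0` otherwise; box scale `S_j`, hull scale `L·S_j`; `cubeOsc` with the bond constant `K₁`.
OUTPUT: §1 constants `K1 = 7^d·8d·(1 + √(2n_adj(2d+7)^d)·L)` (bond), `K2` (second differences); §2 bump data (support radius `(d+2)M S_j`;
`|c∂h| ≤ |c₀|K₁/(M S_j)`; `|Δ_c h| ≤ c₀²·dK₂/(M S_j)²` — `MultiscaleCubesFamily.abs_cubeFam_sub_le` / `abs_cubeFam_secondDiff_le` +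
`MultiscaleRemainderLapTorus.abs_lapH_torus_const_le`); §3 hull clauses (`MultiscaleParametrixHull` BY NAME); §4 oscillation clauses (pv21
`abs_sub_base_le` on the cube comb for adjacent levels, (G1) otherwise; budget `≤ 2a_max·(n_adj·d·K₁·L)/(M S_j²)`); §5 **`parametrix_cubes`**:
`ν·C_rem < M`, `C_rem = remConst d |c₀| a_max C L K₁ (dK₂) (n_adj·d·K₁·L)` ⟹ `1 − R′` unit, `A⁻¹ = G′₀(1 − R′)⁻¹`, `‖(1 − R′)⁻¹‖_{ℓ²} ≤ (1 − C_remν/M)⁻¹`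
— LEVEL-FREE (every constant sees `d, L, n_adj, c₀, a_max, C` only).  Remaining of (w4-a′) after this module: a layer predicate with
(C0)(C1)(C2)(G1)(G2)(G3) from a graded cell family with thickness (the successor module `MultiscaleCubesGeometry`)
(unit `b2b-balaban-beta-d4-p2`, GEN 10, MODEL crew; O.2 skeleton v1.5.2 §8.10 (K″)/(K‴) ROUTE C).

HONEST FRAMING: discharging `BetaPertH` makes Bałaban's UV stability UNCONDITIONAL — NOT the continuum limit, NOT the
Clay problem.  HONEST DEPENDENCY (verbatim): «continuum YM on T⁴ ⇐ BetaPertH ∧ nine spine estimates (0/9 proved);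
BetaPertH ⇐ (D1) ∧ (D4) ∧ CAP+tail; G-an2-4 gates asym, D1 and NE2/3/4.»  THIS MODULE DISCHARGES NOTHING of `BetaPertH`,
asserts NOTHING printed and cites nothing as a fact (ABSOLUTE RULE): [folklore] assembly of this lineage's MODEL theorems BY NAME; the
layer predicate and (C0)–(C2), (G1)–(G3) are DATA.  LOCI (shape only): [B5] = `Balaban1984PropagatorsI` (1.118), (1.121) p. 37;
[B6] = `Balaban1984PropagatorsII` (2.1)–(2.2) p. 224, (2.36)–(2.40) pp. 229–230; [B9] = `Balaban1985BackgroundPropagators`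
(3.87)–(3.90) pp. 408–409, Thm 3.7.  No class change on row D4 (width 0; D4 DISCHARGE NO DATE); NOT BetaPertH, NOT continuum, NOT Clay.
-/

namespace Summit.QuantumFields.BalabanUV.Beta.MultiscaleParametrixCubes

open Finset Function
open Summit.QuantumFields.BalabanUV.Beta.BoxPoincare (Box)
open Summit.QuantumFields.BalabanUV.Beta.MultiscaleCoerciveTorus
open Summit.QuantumFields.BalabanUV.Beta.MultiscaleDecayBudget
open Literature.MathematicalPhysics.QuantumFieldTheory.Balaban1983to89
open B9Thm37Sum B9Thm37Glue B9Thm37GlueTorusInv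
open Literature.MathematicalPhysics.QuantumFieldTheory.Balaban1983to89.B9Thm37GluePU (bsrc btgt bsrc_apply btgt_apply)
open Literature.MathematicalPhysics.QuantumFieldTheory.Balaban1983to89.B9Thm37GlueTorusCov (tblk torusComb)
open Literature.MathematicalPhysics.QuantumFieldTheory.Balaban1983to89.B9Thm37GlueTorusCovPoinc (tdepth_le)
open Literature.MathematicalPhysics.QuantumFieldTheory.Balaban1983to89.B9Thm37GlueTorusCovLevels (levelOp levelSum)
open Literature.MathematicalPhysics.QuantumFieldTheory.Balaban1983to89.B9Thm37GlueTorusCovCT (abs_sub_base_le)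
open B5TorusCover (UT Ctr ctrU)
open B5Leibniz121 (up dn up_dn dist_up_le)
open Summit.QuantumFields.BalabanUV.Beta.CovariantTowerL2
open Summit.QuantumFields.BalabanUV.Beta.MultiscaleRemainderLeibniz
open Summit.QuantumFields.BalabanUV.Beta.MultiscaleParametrix
open Summit.QuantumFields.BalabanUV.Beta.MultiscaleParametrixTorus
open Summit.QuantumFields.BalabanUV.Beta.MultiscaleParametrixHull
open Summit.QuantumFields.BalabanUV.Beta.MultiscaleRemainderLapTorus
open Summit.QuantumFields.BalabanUV.Beta.MultiscalePartitionNormalize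
open Summit.QuantumFields.BalabanUV.Beta.MultiscalePartitionCubes
open Summit.QuantumFields.BalabanUV.Beta.MultiscaleCubesFamily
open Summit.QuantumFields.BalabanUV.Beta.MultiscaleParametrixBoxes (one_le_MS)

noncomputable section

variable {d : ℕ} {N : Fin d → ℕ} [∀ i, NeZero (N i)] {Cp J K : Type} [Fintype Cp] [DecidableEq Cp] [Fintype J] [Fintype K]
  (S : J → ℕ) (hS : ∀ l, 1 ≤ S l) (hdivS : ∀ l i, S l ∣ N i) (lvl : K → J) (zc : (k : K) → Ctr N (S (lvl k)))
  (M : ℕ) (hM : 1 ≤ M) (hMdiv : ∀ j i, M * S j ∣ N i) (inLayer : (j : J) → Ctr N (M * S j) → Prop)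

/-! ## §1 The constants, the hulls and the oscillation budget -/

/-- MODEL bookkeeping: **the bond constant** `K₁ = 7^d·8d·(1 + √(2n_adj(2d+7)^d)·L)` of `abs_cubeFam_sub_le`. [folklore] -/
def K1 (d L nadj : ℕ) : ℝ := 7 ^ d * (8 * d) * (1 + Real.sqrt ((2 * nadj * (2 * d + 7) ^ d : ℕ)) * L)

/-- MODEL bookkeeping: **the second-difference constant** `K₂ = (1 + √k)·7^d(32d² + 104)L² + (2√k + 4k)(7^d·8d·L)²`, `k = 3n_adj(2d+7)^d`,
of `abs_cubeFam_secondDiff_le`. [folklore] -/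
def K2 (d L nadj : ℕ) : ℝ :=
  (1 + Real.sqrt ((3 * nadj * (2 * d + 7) ^ d : ℕ))) * (7 ^ d * (32 * d ^ 2 + 104) * (L : ℝ) ^ 2) +
    (2 * Real.sqrt ((3 * nadj * (2 * d + 7) ^ d : ℕ)) + 4 * ((3 * nadj * (2 * d + 7) ^ d : ℕ) : ℝ)) * (7 ^ d * (8 * d) * (L : ℝ)) ^ 2

omit [∀ i, NeZero (N i)] [Fintype Cp] [DecidableEq Cp] [Fintype J] [Fintype K] in
/-- `K₁ ≥ 0`. [folklore] -/
theorem K1_nonneg (d L nadj : ℕ) : 0 ≤ K1 d L nadj := by unfold K1; positivity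

omit [∀ i, NeZero (N i)] [Fintype Cp] [DecidableEq Cp] [Fintype J] [Fintype K] in
/-- `K₂ ≥ 0`. [folklore] -/
theorem K2_nonneg (d L nadj : ℕ) : 0 ≤ K2 d L nadj := by unfold K2; positivity

open Classical in
/-- MODEL of Ω₀(□): **the hull of a layer cube** — for an ACTIVE box (its bump is not identically zero) the union of the family cells
meeting the `((d+2)M S_j + 1)`-ball round its corner (`MultiscaleParametrixHull.cellHull`), for an inactive box the empty hull.
[cite: Balaban1985BackgroundPropagators, p.408 (Ω₀(□)); Balaban1984PropagatorsII, (2.37) p.229] -/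
def cubeHull (hcover : ∀ x : UT N, ∃ k, ∃ v : Box d (S (lvl k)), cellPt S hS hdivS lvl zc k v = x)
    (p : Σ j : J, Ctr N (M * S j)) (x : UT N) : ℝ :=
  if ∃ y, cubeFam S hS M hM hMdiv inLayer p y ≠ 0 then
    cellHull S hS hdivS lvl zc hcover (ctrU N (M * S p.1) p.2) ((d + 2) * (M * S p.1)) x else 0

/-- MODEL bookkeeping: the oscillation budget of box `(j, z)` on level `l` — `d·S_l·K₁/(M S_j)` on ADJACENT levels
(`S_j ≤ L·S_l ∧ S_l ≤ L·S_j`), `0` on the others. [folklore] -/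
def cubeOsc (L : ℕ) (K₁ : ℝ) (p : Σ j : J, Ctr N (M * S j)) (l : J) : ℝ :=
  if S p.1 ≤ L * S l ∧ S l ≤ L * S p.1 then (d : ℝ) * S l * (K₁ / ((M : ℝ) * S p.1)) else 0

/-! ## §2 The bump data of the cube family -/

section Bump

/-- **Support**: `h_{(j,z)}(x) ≠ 0 ⟹ dist(x, ctrU z) ≤ (d+2)·M S_j` (`thickSq_eq_zero_of_far`, supports preserved by `puNorm`). [folklore] -/
theorem cubeFam_supp [NeZero d] (p : Σ j : J, Ctr N (M * S j)) (x : UT N) (hx : cubeFam S hS M hM hMdiv inLayer p x ≠ 0) :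
    dist x (ctrU N (M * S p.1) p.2) ≤ (((d + 2) * (M * S p.1) : ℕ) : ℕ) := by
  have hraw : rawFam S hS M hM hMdiv inLayer p x ≠ 0 := fun h0 => hx (cubeFam_eq_zero S hS M hM hMdiv inLayer h0)
  have hth := (rawFam_ne_zero S hS M hM hMdiv inLayer hraw).2
  by_contra hfar
  exact hth (thickSq_eq_zero_of_far (one_le_MS S hS hM p.1) (hMdiv p.1) (not_le.mp hfar).le)

/-- **Per-bond first differences**: `|h_p(b₊) − h_p(b₋)| ≤ K₁/(M S_j)` (`abs_cubeFam_sub_le`). [cite: Balaban1984PropagatorsII, (2.36) p.229] -/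
theorem cubeFam_bond_le [NeZero d] [DecidableEq J] (h2N : ∀ j i, 2 * (M * S j) ≤ N i)
    (hcov : ∀ x, ∃ j, inLayer j (tblk (one_le_MS S hS hM j) (hMdiv j) x)) {L : ℕ}
    (hcmp : ∀ (p q : Σ j : J, Ctr N (M * S j)) (x y : UT N), dist x y ≤ 2 →
      rawFam S hS M hM hMdiv inLayer p x ≠ 0 → rawFam S hS M hM hMdiv inLayer q y ≠ 0 → S p.1 ≤ L * S q.1) {nadj : ℕ}
    (hlay : ∀ x, (univ.filter fun j : J => ∃ z : Ctr N (M * S j), rawFam S hS M hM hMdiv inLayer ⟨j, z⟩ x ≠ 0).card ≤ nadj)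
    (p : Σ j : J, Ctr N (M * S j)) (b : UT N × Fin d) :
    |cubeFam S hS M hM hMdiv inLayer p (btgt b) - cubeFam S hS M hM hMdiv inLayer p (bsrc b)| ≤ K1 d L nadj / ((M : ℝ) * S p.1) := by
  obtain ⟨y, μ⟩ := b
  rw [btgt_apply, bsrc_apply]
  have h := abs_cubeFam_sub_le S hS M hM hMdiv inLayer h2N hcov hcmp hlay p y μ
  refine h.trans (le_of_eq ?_)
  unfold K1
  rw [mul_div_assoc', ← add_div]
  congr 1
  ring

/-- **The first datum `|c∂h| ≤ |c₀|·K₁/(M S_j)`** for a constant bond weight. [folklore] -/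
theorem cubeFam_cdh_le [NeZero d] [DecidableEq J] (h2N : ∀ j i, 2 * (M * S j) ≤ N i)
    (hcov : ∀ x, ∃ j, inLayer j (tblk (one_le_MS S hS hM j) (hMdiv j) x)) {L : ℕ}
    (hcmp : ∀ (p q : Σ j : J, Ctr N (M * S j)) (x y : UT N), dist x y ≤ 2 →
      rawFam S hS M hM hMdiv inLayer p x ≠ 0 → rawFam S hS M hM hMdiv inLayer q y ≠ 0 → S p.1 ≤ L * S q.1) {nadj : ℕ}
    (hlay : ∀ x, (univ.filter fun j : J => ∃ z : Ctr N (M * S j), rawFam S hS M hM hMdiv inLayer ⟨j, z⟩ x ≠ 0).card ≤ nadj)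
    {c : UT N × Fin d → ℝ} {c₀ : ℝ} (hc : ∀ b, c b = c₀) (p : Σ j : J, Ctr N (M * S j)) (b : UT N × Fin d) :
    |c b * (cubeFam S hS M hM hMdiv inLayer p (btgt b) - cubeFam S hS M hM hMdiv inLayer p (bsrc b))| ≤
      |c₀| * K1 d L nadj / ((M : ℝ) * S p.1) := by
  rw [hc, abs_mul, mul_div_assoc]
  exact mul_le_mul_of_nonneg_left (cubeFam_bond_le S hS M hM hMdiv inLayer h2N hcov hcmp hlay p b) (abs_nonneg _)

/-- **Centred second differences** of the cube bumps: `≤ K₂/(M S_j)²` (`abs_cubeFam_secondDiff_le`). [cite: Balaban1984PropagatorsII, (2.36) p.229 + (2.40) p.230] -/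
theorem cubeFam_secondDiff_le [NeZero d] [DecidableEq J] (h2N : ∀ j i, 2 * (M * S j) ≤ N i)
    (hcov : ∀ x, ∃ j, inLayer j (tblk (one_le_MS S hS hM j) (hMdiv j) x)) {L : ℕ}
    (hcmp : ∀ (p q : Σ j : J, Ctr N (M * S j)) (x y : UT N), dist x y ≤ 2 →
      rawFam S hS M hM hMdiv inLayer p x ≠ 0 → rawFam S hS M hM hMdiv inLayer q y ≠ 0 → S p.1 ≤ L * S q.1) {nadj : ℕ}
    (hlay : ∀ x, (univ.filter fun j : J => ∃ z : Ctr N (M * S j), rawFam S hS M hM hMdiv inLayer ⟨j, z⟩ x ≠ 0).card ≤ nadj)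
    (p : Σ j : J, Ctr N (M * S j)) (x : UT N) (μ : Fin d) :
    |cubeFam S hS M hM hMdiv inLayer p (up x μ) - 2 * cubeFam S hS M hM hMdiv inLayer p x +
        cubeFam S hS M hM hMdiv inLayer p (dn x μ)| ≤ K2 d L nadj / ((M : ℝ) * S p.1) ^ 2 := by
  have h := abs_cubeFam_secondDiff_le S hS M hM hMdiv inLayer h2N hcov hcmp hlay p x μ
  refine h.trans (le_of_eq ?_)
  unfold K2
  rw [div_pow, mul_div_assoc', mul_div_assoc', ← add_div]

/-- **The second datum `|Δ_c h| ≤ c₀²·d·K₂/(M S_j)²`** for a constant bond weight (`abs_lapH_torus_const_le`).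
[cite: Balaban1985BackgroundPropagators, (3.88) p.409] -/
theorem cubeFam_lap_le [NeZero d] [DecidableEq J] (h2N : ∀ j i, 2 * (M * S j) ≤ N i)
    (hcov : ∀ x, ∃ j, inLayer j (tblk (one_le_MS S hS hM j) (hMdiv j) x)) {L : ℕ}
    (hcmp : ∀ (p q : Σ j : J, Ctr N (M * S j)) (x y : UT N), dist x y ≤ 2 →
      rawFam S hS M hM hMdiv inLayer p x ≠ 0 → rawFam S hS M hM hMdiv inLayer q y ≠ 0 → S p.1 ≤ L * S q.1) {nadj : ℕ}
    (hlay : ∀ x, (univ.filter fun j : J => ∃ z : Ctr N (M * S j), rawFam S hS M hM hMdiv inLayer ⟨j, z⟩ x ≠ 0).card ≤ nadj)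
    {c : UT N × Fin d → ℝ} {c₀ : ℝ} (hc : ∀ b, c b = c₀) (p : Σ j : J, Ctr N (M * S j)) (x : UT N) :
    |lapH bsrc btgt c (cubeFam S hS M hM hMdiv inLayer p) x| ≤ |c₀| ^ 2 * (d * K2 d L nadj) / ((M : ℝ) * S p.1) ^ 2 := by
  have h := abs_lapH_torus_const_le hc (cubeFam S hS M hM hMdiv inLayer p) x
    (fun μ => cubeFam_secondDiff_le S hS M hM hMdiv inLayer h2N hcov hcmp hlay p x μ)
  rw [sq_abs]
  calc |lapH bsrc btgt c (cubeFam S hS M hM hMdiv inLayer p) x| ≤ c₀ ^ 2 * (d * (K2 d L nadj / ((M : ℝ) * S p.1) ^ 2)) := h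
    _ = c₀ ^ 2 * (d * K2 d L nadj) / ((M : ℝ) * S p.1) ^ 2 := by ring

end Bump

/-! ## §3 The hull clauses of the cube family -/

section Hulls

variable (hcover : ∀ x : UT N, ∃ k, ∃ v : Box d (S (lvl k)), cellPt S hS hdivS lvl zc k v = x)

omit [Fintype K] in
/-- The five hull clauses of `parametrix_torus_adapted` for the cube family: `hχ`, `hχcell`, `hsite`, `hbond`, and `hH` with
hull scale `L·S_j` under (G2). [cite: Balaban1985BackgroundPropagators, p.408 (Ω₀(□))] -/
theorem cubeHull_clauses [NeZero d]
    (hdisj : ∀ k k' v v', cellPt S hS hdivS lvl zc k v = cellPt S hS hdivS lvl zc k' v' → k = k') {L : ℕ}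
    (hballs : ∀ (j : J) (z : Ctr N (M * S j)), (∃ y, cubeFam S hS M hM hMdiv inLayer ⟨j, z⟩ y ≠ 0) →
      ∀ k, CellMeets S hS hdivS lvl zc k (ctrU N (M * S j) z) ((((d + 2) * (M * S j) : ℕ) : ℝ) + 1) → S (lvl k) ≤ L * S j) :
    (∀ p x, cubeHull S hS hdivS lvl zc M hM hMdiv inLayer hcover p x = 0 ∨ cubeHull S hS hdivS lvl zc M hM hMdiv inLayer hcover p x = 1) ∧
      (∀ p k v, cubeHull S hS hdivS lvl zc M hM hMdiv inLayer hcover p (cellPt S hS hdivS lvl zc k v) =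
        cubeHull S hS hdivS lvl zc M hM hMdiv inLayer hcover p (ctrU N (S (lvl k)) (zc k))) ∧
      (∀ p x, cubeFam S hS M hM hMdiv inLayer p x ≠ 0 → cubeHull S hS hdivS lvl zc M hM hMdiv inLayer hcover p x = 1) ∧
      (∀ p b, (cubeFam S hS M hM hMdiv inLayer p (bsrc b) ≠ 0 ∨ cubeFam S hS M hM hMdiv inLayer p (btgt b) ≠ 0) →
        cubeHull S hS hdivS lvl zc M hM hMdiv inLayer hcover p (bsrc b) = 1 ∧
          cubeHull S hS hdivS lvl zc M hM hMdiv inLayer hcover p (btgt b) = 1) ∧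
      (∀ p x, cubeHull S hS hdivS lvl zc M hM hMdiv inLayer hcover p x = 1 → siteScale S hS hdivS lvl zc hcover x ≤ L * S p.1) := by
  classical
  have hsupp : ∀ (p : Σ j : J, Ctr N (M * S j)) x, cubeFam S hS M hM hMdiv inLayer p x ≠ 0 →
      dist x (ctrU N (M * S p.1) p.2) ≤ ((((d + 2) * (M * S p.1)) : ℕ) : ℕ) :=
    fun p x hx => cubeFam_supp S hS M hM hMdiv inLayer p x hx
  refine ⟨fun p x => ?_, fun p k v => ?_, fun p x hx => ?_, fun p b hb => ?_, fun p x hx => ?_⟩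
  · unfold cubeHull; split_ifs; exacts [cellHull_zero_or_one S hS hdivS lvl zc hcover _ _ x, Or.inl rfl]
  · unfold cubeHull; split_ifs; exacts [cellHull_cellPt S hS hdivS lvl zc hcover hdisj _ _ k v, rfl]
  · unfold cubeHull
    rw [if_pos ⟨x, hx⟩]
    exact hsite_of_supp S hS hdivS lvl zc hcover _ _ (hsupp p) x hx
  · unfold cubeHull
    have hact : ∃ y, cubeFam S hS M hM hMdiv inLayer p y ≠ 0 := hb.elim (fun h => ⟨_, h⟩) fun h => ⟨_, h⟩
    rw [if_pos hact, if_pos hact]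
    exact hbond_of_supp S hS hdivS lvl zc hcover _ _ (hsupp p) b hb
  · unfold cubeHull at hx
    by_cases hact : ∃ y, cubeFam S hS M hM hMdiv inLayer p y ≠ 0
    · rw [if_pos hact] at hx
      obtain ⟨j, z⟩ := p
      exact scale_le_of_cellHull S hS hdivS lvl zc hcover _ _ (hballs j z hact) x hx
    · rw [if_neg hact] at hx
      exact absurd hx (by norm_num)

end Hulls

/-! ## §4 The oscillation clauses -/

section Osc

variable (ω : J → UT N → ℝ)

omit [Fintype K] in
/-- **The oscillation of a cube bump over a weighted level-`l` block**: `≤ cubeOsc` — on adjacent levels by the comb-path estimate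
(pv21 `abs_sub_base_le` on the cube comb, depth `≤ d(S_l − 1)`), on the other levels `0` because the bump vanishes on their cells (G1).
[folklore] -/
theorem cubeFam_osc_le [NeZero d] [DecidableEq J]
    (hsupp : ∀ l x, ω l (ctrU N (S l) (tblk (hS l) (hdivS l) x)) ≠ 0 → ∃ k v, lvl k = l ∧ cellPt S hS hdivS lvl zc k v = x)
    (h2N : ∀ j i, 2 * (M * S j) ≤ N i) (hcov : ∀ x, ∃ j, inLayer j (tblk (one_le_MS S hS hM j) (hMdiv j) x)) {L : ℕ}
    (hcmp : ∀ (p q : Σ j : J, Ctr N (M * S j)) (x y : UT N), dist x y ≤ 2 →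
      rawFam S hS M hM hMdiv inLayer p x ≠ 0 → rawFam S hS M hM hMdiv inLayer q y ≠ 0 → S p.1 ≤ L * S q.1) {nadj : ℕ}
    (hlay : ∀ x, (univ.filter fun j : J => ∃ z : Ctr N (M * S j), rawFam S hS M hM hMdiv inLayer ⟨j, z⟩ x ≠ 0).card ≤ nadj)
    (hfar : ∀ (p : Σ j : J, Ctr N (M * S j)) k, ¬ (S p.1 ≤ L * S (lvl k) ∧ S (lvl k) ≤ L * S p.1) →
      ∀ v, cubeFam S hS M hM hMdiv inLayer p (cellPt S hS hdivS lvl zc k v) = 0)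
    (p : Σ j : J, Ctr N (M * S j)) (l : J) (x : UT N) (hx : ω l (ctrU N (S l) (tblk (hS l) (hdivS l) x)) ≠ 0) :
    |cubeFam S hS M hM hMdiv inLayer p x - cubeFam S hS M hM hMdiv inLayer p (ctrU N (S l) (tblk (hS l) (hdivS l) x))| ≤
      cubeOsc (d := d) S M L (K1 d L nadj) p l := by
  unfold cubeOsc
  by_cases hadj : S p.1 ≤ L * S l ∧ S l ≤ L * S p.1
  · rw [if_pos hadj]
    have hθ := cubeFam_bond_le S hS M hM hMdiv inLayer h2N hcov hcmp hlay p
    have hpath := abs_sub_base_le (torusComb (hS l) (hdivS l)) (cubeFam S hS M hM hMdiv inLayer p) hθ x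
    have hdep : ((torusComb (N := N) (hS l) (hdivS l)).depth x : ℝ) ≤ (d : ℝ) * S l := by
      have h1 := tdepth_le (N := N) (hS l) x
      have h2 : d * (S l - 1) ≤ d * S l := Nat.mul_le_mul_left d (Nat.sub_le _ _)
      exact_mod_cast h1.trans h2
    have hθ0 : 0 ≤ K1 d L nadj / ((M : ℝ) * S p.1) := div_nonneg (K1_nonneg d L nadj) (by positivity)
    calc |cubeFam S hS M hM hMdiv inLayer p x - cubeFam S hS M hM hMdiv inLayer p (ctrU N (S l) (tblk (hS l) (hdivS l) x))|
        ≤ ((torusComb (N := N) (hS l) (hdivS l)).depth x : ℝ) * (K1 d L nadj / ((M : ℝ) * S p.1)) := hpath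
      _ ≤ (d : ℝ) * S l * (K1 d L nadj / ((M : ℝ) * S p.1)) := mul_le_mul_of_nonneg_right hdep hθ0
  · rw [if_neg hadj]
    obtain ⟨k, v, hkl, hkv⟩ := hsupp l x hx
    subst hkl
    have hx0 : cubeFam S hS M hM hMdiv inLayer p x = 0 := by rw [← hkv]; exact hfar p k hadj v
    have hcorner : ctrU N (S (lvl k)) (tblk (hS (lvl k)) (hdivS (lvl k)) x) = cellPt S hS hdivS lvl zc k (fun _ => ⟨0, hS (lvl k)⟩) := by
      rw [← hkv, cellPt, tblk_cubePt, cellPt, cubePt_zero]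
    have hc0 : cubeFam S hS M hM hMdiv inLayer p (ctrU N (S (lvl k)) (tblk (hS (lvl k)) (hdivS (lvl k)) x)) = 0 := by
      rw [hcorner]; exact hfar p k hadj _
    rw [hx0, hc0, sub_zero, abs_zero]

omit [∀ i, NeZero (N i)] [Fintype K] in
/-- **The oscillation budget of a box**: `Σ_l |a_l|·2ω̄_l²S_l^d·m_{(j,z),l} ≤ 2a_max·(n_adj·d·K₁·L)/(M S_j²)` under print-size weights from
above and at most `n_adj` levels adjacent to `j`. [folklore] -/
theorem cubeOsc_sum_le (hS : ∀ l, 1 ≤ S l) (hM : 1 ≤ M) (a : J → ℝ) {wmax : J → ℝ} {amax : ℝ} (hamax : 0 ≤ amax)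
    (hscaleW : ∀ l, |a l| * (wmax l ^ 2 * ((S l ^ d : ℕ) : ℝ)) ≤ amax / (S l : ℝ) ^ 2) {K₁ : ℝ} (hK₁ : 0 ≤ K₁)
    {L : ℕ} (hL : 1 ≤ L) {nadj : ℕ} (hadj : ∀ j, (univ.filter fun l => S j ≤ L * S l ∧ S l ≤ L * S j).card ≤ nadj)
    (p : Σ j : J, Ctr N (M * S j)) :
    ∑ l, |a l| * (2 * (wmax l ^ 2 * ((S l ^ d : ℕ) : ℝ)) * cubeOsc (d := d) S M L K₁ p l) ≤
      2 * amax * ((nadj : ℝ) * d * K₁ * L) / ((M : ℝ) * (S p.1 : ℝ) ^ 2) := by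
  classical
  obtain ⟨j, z⟩ := p
  set θ : ℝ := K₁ / ((M : ℝ) * S j) with hθ
  have hSj : (1 : ℝ) ≤ S j := by exact_mod_cast hS j
  have hM0 : (0 : ℝ) < M := by exact_mod_cast hM
  have hθ0 : 0 ≤ θ := by positivity
  set B : ℝ := 2 * amax * d * θ * L / S j with hB
  have hB0 : 0 ≤ B := by positivity
  have hterm : ∀ l, |a l| * (2 * (wmax l ^ 2 * ((S l ^ d : ℕ) : ℝ)) * cubeOsc (d := d) S M L K₁ ⟨j, z⟩ l) ≤
      if S j ≤ L * S l ∧ S l ≤ L * S j then B else 0 := by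
    intro l
    unfold cubeOsc
    by_cases h : S j ≤ L * S l ∧ S l ≤ L * S j
    · rw [if_pos h, if_pos h]
      have hSl : (0 : ℝ) < S l := by exact_mod_cast hS l
      have hcmp : (S j : ℝ) ≤ L * S l := by exact_mod_cast h.1
      calc |a l| * (2 * (wmax l ^ 2 * ((S l ^ d : ℕ) : ℝ)) * ((d : ℝ) * S l * θ))
          = 2 * d * θ * S l * (|a l| * (wmax l ^ 2 * ((S l ^ d : ℕ) : ℝ))) := by ring
        _ ≤ 2 * d * θ * S l * (amax / (S l : ℝ) ^ 2) := mul_le_mul_of_nonneg_left (hscaleW l) (by positivity)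
        _ = 2 * amax * d * θ * (1 / S l) := by field_simp
        _ ≤ 2 * amax * d * θ * (L / S j) := by
            refine mul_le_mul_of_nonneg_left ?_ (by positivity)
            rw [div_le_div_iff₀ hSl (by linarith), one_mul]
            exact hcmp
        _ = B := by rw [hB]; ring
    · rw [if_neg h, if_neg h]
      simp
  calc ∑ l, |a l| * (2 * (wmax l ^ 2 * ((S l ^ d : ℕ) : ℝ)) * cubeOsc (d := d) S M L K₁ ⟨j, z⟩ l)
      ≤ ∑ l, (if S j ≤ L * S l ∧ S l ≤ L * S j then B else 0) := Finset.sum_le_sum fun l _ => hterm l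
    _ = ((univ.filter fun l => S j ≤ L * S l ∧ S l ≤ L * S j).card : ℝ) * B := by rw [Finset.sum_ite, Finset.sum_const_zero, add_zero,
        Finset.sum_const, nsmul_eq_mul]
    _ ≤ (nadj : ℝ) * B := mul_le_mul_of_nonneg_right (by exact_mod_cast hadj j) hB0
    _ = 2 * amax * ((nadj : ℝ) * d * K₁ * L) / ((M : ℝ) * (S j : ℝ) ^ 2) := by
        rw [hB, hθ]
        field_simp

end Osc

/-! ## §5 THE END: the level-free parametrix for the cube family of a layer predicate -/

section End

variable (Rm : UT N × Fin d → Cp → Cp → ℝ) (T : J → UT N → Cp → Cp → ℝ) (a : J → ℝ) (ω : J → UT N → ℝ)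
  (c : UT N × Fin d → ℝ)

/-- **THE LEVEL-FREE PARAMETRIX FOR THE CUBE FAMILY OF A LAYER PREDICATE (MODEL; node (w4-a′), Route C, reduced to the layer predicate's
(C0)(C1)(C2)(G1) + the two counts (G2)(G3)).**  See the module docstring for the input list; conclusion: with
`C_rem = remConst d |c₀| a_max C L K₁ (d·K₂) (n_adj·d·K₁·L)` and `C_rem·ν/M < 1`, `1 − R′` is a unit, `A⁻¹ = G′₀(1 − R′)⁻¹`,
`‖(1 − R′)⁻¹‖_{ℓ²} ≤ (1 − C_remν/M)⁻¹` for the remainder `R′` and local part `G′₀` of the cube family `cubeFam`/`cubeHull`.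
[cite: Balaban1985BackgroundPropagators, (3.87)–(3.90) pp.408–409 + Thm 3.7; Balaban1984PropagatorsII, (2.36)–(2.40) pp.229–230; Balaban1984PropagatorsI, (1.118) p.37] -/
theorem parametrix_cubes [NeZero d] [DecidableEq J]
    (hdisj : ∀ k k' v v', cellPt S hS hdivS lvl zc k v = cellPt S hS hdivS lvl zc k' v' → k = k')
    (hcover : ∀ x : UT N, ∃ k, ∃ v : Box d (S (lvl k)), cellPt S hS hdivS lvl zc k v = x)
    (hRm : ∀ b i j, ∑ k, Rm b k i * Rm b k j = if i = j then (1 : ℝ) else 0)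
    (hT : ∀ l x i i', ∑ k, T l x k i * T l x k i' = if i = i' then (1 : ℝ) else 0) (ha : ∀ j, 0 ≤ a j)
    (hsupp : ∀ l x, ω l (ctrU N (S l) (tblk (hS l) (hdivS l) x)) ≠ 0 → ∃ k v, lvl k = l ∧ cellPt S hS hdivS lvl zc k v = x)
    {wmax : J → ℝ} (hw0 : ∀ l, 0 ≤ wmax l) (hw : ∀ l x, |ω l (ctrU N (S l) (tblk (hS l) (hdivS l) x))| ≤ wmax l)
    {amax : ℝ} (hamax : 0 ≤ amax) (hscaleW : ∀ l, |a l| * (wmax l ^ 2 * ((S l ^ d : ℕ) : ℝ)) ≤ amax / (S l : ℝ) ^ 2)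
    {c₀ : ℝ} (hc : ∀ b, c b = c₀) {C : ℝ} (hC : 0 < C)
    (hcoer : ∀ f : UT N × Cp → ℝ,
      C * ∑ k, ((S (lvl k) : ℝ) ^ 2)⁻¹ * ∑ v : Box d (S (lvl k)), ∑ i, f (cellPt S hS hdivS lvl zc k v, i) ^ 2 ≤
        ∑ p, f p * levelOp bsrc btgt c Rm (fun l x => ctrU N (S l) (tblk (hS l) (hdivS l) x))
          (fun l x => ω l (ctrU N (S l) (tblk (hS l) (hdivS l) x))) T a f p)
    (h2N : ∀ j i, 2 * (M * S j) ≤ N i) (L : ℕ) (hL : 1 ≤ L)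
    (hcov : ∀ x, ∃ j, inLayer j (tblk (one_le_MS S hS hM j) (hMdiv j) x))
    (hcmp : ∀ (p q : Σ j : J, Ctr N (M * S j)) (x y : UT N), dist x y ≤ 2 →
      rawFam S hS M hM hMdiv inLayer p x ≠ 0 → rawFam S hS M hM hMdiv inLayer q y ≠ 0 → S p.1 ≤ L * S q.1) {nadj : ℕ}
    (hlay : ∀ x, (univ.filter fun j : J => ∃ z : Ctr N (M * S j), rawFam S hS M hM hMdiv inLayer ⟨j, z⟩ x ≠ 0).card ≤ nadj)
    (hfar : ∀ (p : Σ j : J, Ctr N (M * S j)) k, ¬ (S p.1 ≤ L * S (lvl k) ∧ S (lvl k) ≤ L * S p.1) →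
      ∀ v, cubeFam S hS M hM hMdiv inLayer p (cellPt S hS hdivS lvl zc k v) = 0)
    (hadj : ∀ j, (univ.filter fun l => S j ≤ L * S l ∧ S l ≤ L * S j).card ≤ nadj)
    (hballs : ∀ (j : J) (z : Ctr N (M * S j)), (∃ y, cubeFam S hS M hM hMdiv inLayer ⟨j, z⟩ y ≠ 0) →
      ∀ k, CellMeets S hS hdivS lvl zc k (ctrU N (M * S j) z) ((((d + 2) * (M * S j) : ℕ) : ℝ) + 1) → S (lvl k) ≤ L * S j)
    {ν : ℝ} (hν0 : 0 ≤ ν) (hν : ∀ x, ∑ p : Σ j : J, Ctr N (M * S j), cubeHull S hS hdivS lvl zc M hM hMdiv inLayer hcover p x ≤ ν)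
    (hsmall : remConst d |c₀| amax C L (K1 d L nadj) (d * K2 d L nadj) (nadj * d * K1 d L nadj * L) / M * ν < 1) :
    IsUnit (1 - Rsum bsrc btgt c Rm
        (levelSum (fun l x => ctrU N (S l) (tblk (hS l) (hdivS l) x)) (fun l x => ω l (ctrU N (S l) (tblk (hS l) (hdivS l) x))) T a)
        (levelOp bsrc btgt c Rm (fun l x => ctrU N (S l) (tblk (hS l) (hdivS l) x))
          (fun l x => ω l (ctrU N (S l) (tblk (hS l) (hdivS l) x))) T a)
        (cubeFam S hS M hM hMdiv inLayer) (cubeHull S hS hdivS lvl zc M hM hMdiv inLayer hcover)) ∧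
      Ring.inverse (levelOp bsrc btgt c Rm (fun l x => ctrU N (S l) (tblk (hS l) (hdivS l) x))
          (fun l x => ω l (ctrU N (S l) (tblk (hS l) (hdivS l) x))) T a) =
        G0sum (levelOp bsrc btgt c Rm (fun l x => ctrU N (S l) (tblk (hS l) (hdivS l) x))
          (fun l x => ω l (ctrU N (S l) (tblk (hS l) (hdivS l) x))) T a) (cubeFam S hS M hM hMdiv inLayer)
          (cubeHull S hS hdivS lvl zc M hM hMdiv inLayer hcover) *
        Ring.inverse (1 - Rsum bsrc btgt c Rm
          (levelSum (fun l x => ctrU N (S l) (tblk (hS l) (hdivS l) x)) (fun l x => ω l (ctrU N (S l) (tblk (hS l) (hdivS l) x))) T a)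
          (levelOp bsrc btgt c Rm (fun l x => ctrU N (S l) (tblk (hS l) (hdivS l) x))
            (fun l x => ω l (ctrU N (S l) (tblk (hS l) (hdivS l) x))) T a)
          (cubeFam S hS M hM hMdiv inLayer) (cubeHull S hS hdivS lvl zc M hM hMdiv inLayer hcover)) ∧
      L2Bound (Ring.inverse (1 - Rsum bsrc btgt c Rm
          (levelSum (fun l x => ctrU N (S l) (tblk (hS l) (hdivS l) x)) (fun l x => ω l (ctrU N (S l) (tblk (hS l) (hdivS l) x))) T a)
          (levelOp bsrc btgt c Rm (fun l x => ctrU N (S l) (tblk (hS l) (hdivS l) x))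
            (fun l x => ω l (ctrU N (S l) (tblk (hS l) (hdivS l) x))) T a)
          (cubeFam S hS M hM hMdiv inLayer) (cubeHull S hS hdivS lvl zc M hM hMdiv inLayer hcover)))
        (1 - remConst d |c₀| amax C L (K1 d L nadj) (d * K2 d L nadj) (nadj * d * K1 d L nadj * L) / M * ν)⁻¹ := by
  obtain ⟨hχ, hχcell, hsite, hbond, hH⟩ :=
    cubeHull_clauses S hS hdivS lvl zc M hM hMdiv inLayer hcover hdisj hballs
  have hMR : (1 : ℝ) ≤ M := by exact_mod_cast hM
  have hLR : (1 : ℝ) ≤ L := by exact_mod_cast hL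
  have hK1 := K1_nonneg d L nadj
  have hK2 := K2_nonneg d L nadj
  exact parametrix_torus_adapted S hS hdivS lvl zc Rm T a ω c hdisj hcover hRm hT ha hsupp hw0 hw (abs_nonneg c₀) hC hcoer
    hMR hLR hamax hK1 (by positivity) (by positivity) (cubeFam S hS M hM hMdiv inLayer)
    (cubeFam_sum_sq S hS M hM hMdiv inLayer h2N hcov) (abs_cubeFam_le_one S hS M hM hMdiv inLayer)
    (cubeHull S hS hdivS lvl zc M hM hMdiv inLayer hcover) hχ hχcell hsite hbond
    (fun p => S p.1) (fun p => L * S p.1) (fun p => hS p.1)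
    (fun p => Nat.one_le_iff_ne_zero.mpr (Nat.mul_ne_zero (by omega) (by have := hS p.1; omega)))
    (fun p => by push_cast; exact le_rfl) hH
    (fun p b => cubeFam_cdh_le S hS M hM hMdiv inLayer h2N hcov hcmp hlay hc p b)
    (fun p x => cubeFam_lap_le S hS M hM hMdiv inLayer h2N hcov hcmp hlay hc p x)
    (fun p l => cubeOsc (d := d) S M L (K1 d L nadj) p l)
    (fun p l => by unfold cubeOsc; split_ifs <;> positivity)
    (fun p l x hx => cubeFam_osc_le S hS hdivS lvl zc M hM hMdiv inLayer ω hsupp h2N hcov hcmp hlay hfar p l x hx)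
    (fun p => cubeOsc_sum_le S M hS hM a hamax hscaleW hK1 hL hadj p) hν0 hν hsmall

end End

end

end Summit.QuantumFields.BalabanUV.Beta.MultiscaleParametrixCubes
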